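import Summits.KontsevichZagierPeriods.Zeta5Search.Zudilin2003Rates
import Literature.NumberTheory.Irrationality.Zudilin2003.CatalanRemarks
import Literature.NumberTheory.Irrationality.KrattenthalerRivoal2008.LeadingCoefficient
import HarnessLib

/-!
# ζ(5) search, Catalan arm — the record effective exponent `0.5242…` for `G` is attained by Zudilin's 2003 family

Cell `pub-zeta5` (lit/lead seat, generation 5, 2026-08-20).
HONEST FRAMING: systematic search; no irrationality claim unless certified.  Nothing here bears on the
irrationality of `G`: an effective exponent `< 1` never does.

OUR combination of tree theorems with two PRINTED results:

* PRINTED [KrattenthalerRivoal2008Catalan, Thms 1–2] (typed: `Zudilin2003.krTheorems`, statement only): for the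
  solutions `u_n, v_n` of Zudilin's recursion [Zudilin2003Catalan, (2)–(4)], `2^{4n+2} u_n ∈ ℤ` and
  `2^{4n+2} d_{2n}² v_n ∈ ℤ` (`n ≥ 1`, `d_m = lcm(1,…,m)`).
* PRINTED [Zudilin2003Catalan, Theorem 3] (not typed): `u_n G − v_n = ((−1)^n/4) J(n,n,n;2n,2n)` with Nesterenko's
  double integral `J` (`Literature…Nesterenko2016.J`), so that Nesterenko's record pair `(p_n, q_n)`,
  `4^{2n} d_{2n}² J = q_n G − p_n` [Nesterenko2016; Viola2022OWR p. 1100 (1)], is `(−1)^n (P_n, Q_n)` with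
  `Q_n = 2^{4n+2} d_{2n}² u_n`, `P_n = 2^{4n+2} d_{2n}² v_n` — this identification is CITED here, not proved.
* TREE THEOREMS (cell, P1/typer/lit gens 2–5): `log u_n / n → log((1+√5)/2)⁵` (`Zudilin2003Growth.tendsto_log_u_div`),
  `log|G − v_n/u_n| / n → −2 log((1+√5)/2)⁵` (`tendsto_log_abs_sub_catalan_div`), `log d_N / N → 1` (PNT,
  `tendsto_log_lcmUpto_div`), and the enclosures `log((√5−1)/2) ∈ (−0.4813, −0.4812)`, `log 2 < 0.6931471808`.

RESULTS (this file):
* `tendsto_log_Q_div` — `log Q_n / n → 4 log 2 + 4 + log((1+√5)/2)⁵ = 9.17864…` for `Q_n = 2^{4n+2} d_{2n}² u_n`;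
* `eventually_abs_sub_lt_rpow` — UNCONDITIONAL: eventually `0 < |G − v_n/u_n| < Q_n^{−0.5242}`
  (limit of the log-ratio: `2·2.40606/9.17865 = 0.524273 > 0.5242`; the slack is `≈ 6·10⁻⁴`, inside the enclosures);
* `record_of_krTheorems` — modulo the cited integrality: integer pairs `(P_n, Q_n)` with `|Q_n| = Q_n` as above and
  eventually `0 < |G − P_n/Q_n| < |Q_n|^{−0.5242}`, i.e. the second clause of `Nesterenko2016.theorem_main` (ii) in
  its typed shape, realised by Zudilin's sequence.
So the Catalan row G of the census sits AT the printed record `0.5242…` once the denominators proved in 2008 are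
used (with [Zudilin2003Catalan, Thm 1]'s denominators `2^{4n+3} D_{2n−1}³` alone the exponent is `0.43047`).
-/

noncomputable section

open Filter Real
open scoped Topology

namespace Summit.KontsevichZagierPeriods.Zeta5Search

namespace CatalanRecord

open Literature.NumberTheory.Irrationality.Zudilin2003
open Literature.NumberTheory.Transcendental (catalanConstant tendsto_log_lcmUpto_div)
open Zudilin2003Growth (uR vR uR_pos tendsto_log_u_div tendsto_log_abs_sub_catalan_div form_ne_zero)

/-- The Krattenthaler–Rivoal / Nesterenko normaliser times `u_n`: `Q_n = 2^{4n+2} d_{2n}² u_n` (as a real number). -/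
def Q (n : ℕ) : ℝ := 2 ^ (4 * n + 2) * (Nat.lcmUpto (2 * n) : ℝ) ^ 2 * (u n : ℝ)

/-- `Q_n > 0` (`u_n > 0`, `d_{2n} ≥ 1`). -/
theorem Q_pos (n : ℕ) : 0 < Q n := by
  unfold Q
  have hd : (0 : ℝ) < (Nat.lcmUpto (2 * n) : ℝ) := by exact_mod_cast Nat.lcmUpto_pos _
  have hu : (0 : ℝ) < (u n : ℝ) := uR_pos n
  positivity

/-- `log d_{2n} / n → 2` (prime number theorem). -/
theorem tendsto_log_lcmUpto_two_mul_div :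
    Tendsto (fun n : ℕ => Real.log (Nat.lcmUpto (2 * n)) / n) atTop (𝓝 2) := by
  have hsub : Tendsto (fun n : ℕ => 2 * n) atTop atTop :=
    tendsto_atTop_atTop.mpr fun b => ⟨b, fun n hn => by omega⟩
  have h1 : Tendsto (fun n : ℕ => Real.log (Nat.lcmUpto (2 * n)) / ((2 * n : ℕ) : ℝ)) atTop (𝓝 1) :=
    tendsto_log_lcmUpto_div.comp hsub
  have h2 := h1.const_mul 2
  rw [mul_one] at h2
  refine h2.congr' ?_
  filter_upwards [eventually_ge_atTop 1] with n hn
  have hn' : (n : ℝ) ≠ 0 := by exact_mod_cast (show n ≠ 0 by omega)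
  push_cast
  field_simp

/-- **`log Q_n / n → 4 log 2 + 4 + log((1+√5)/2)⁵`** (`= 9.17864…`). -/
theorem tendsto_log_Q_div :
    Tendsto (fun n : ℕ => Real.log (Q n) / n) atTop
      (𝓝 (4 * Real.log 2 + 4 + Real.log (((1 + Real.sqrt 5) / 2) ^ 5))) := by
  have hA : Tendsto (fun n : ℕ => ((4 * n + 2 : ℕ) : ℝ) * Real.log 2 / n) atTop (𝓝 (4 * Real.log 2)) := by
    have h4 : Tendsto (fun n : ℕ => (4 + 2 * (1 / (n : ℝ))) * Real.log 2) atTop (𝓝 ((4 + 2 * 0) * Real.log 2)) :=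
      (tendsto_const_nhds.add (tendsto_one_div_atTop_nhds_zero_nat.const_mul 2)).mul_const _
    rw [mul_zero, add_zero] at h4
    refine h4.congr' ?_
    filter_upwards [eventually_ge_atTop 1] with n hn
    have hn' : (n : ℝ) ≠ 0 := by exact_mod_cast (show n ≠ 0 by omega)
    push_cast
    field_simp
  have hB := tendsto_log_lcmUpto_two_mul_div.const_mul 2
  have hC := tendsto_log_u_div
  have hsum := (hA.add hB).add hC
  rw [show (4 : ℝ) * Real.log 2 + 4 + Real.log (((1 + Real.sqrt 5) / 2) ^ 5)
      = 4 * Real.log 2 + 2 * 2 + Real.log (((1 + Real.sqrt 5) / 2) ^ 5) by norm_num]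
  refine hsum.congr' ?_
  filter_upwards [eventually_ge_atTop 1] with n hn
  have hd : (0 : ℝ) < (Nat.lcmUpto (2 * n) : ℝ) := by exact_mod_cast Nat.lcmUpto_pos _
  have hu : (0 : ℝ) < (u n : ℝ) := uR_pos n
  have h2 : (0 : ℝ) < (2 : ℝ) ^ (4 * n + 2) := by positivity
  have hn' : (n : ℝ) ≠ 0 := by exact_mod_cast (show n ≠ 0 by omega)
  unfold Q
  rw [Real.log_mul (mul_pos h2 (pow_pos hd 2)).ne' hu.ne', Real.log_mul h2.ne' (pow_pos hd 2).ne',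
    Real.log_pow, Real.log_pow]
  push_cast
  field_simp

/-- `log((1+√5)/2)⁵ = −5 log((√5−1)/2)` (the two golden numbers are reciprocal). -/
theorem log_golden_fifth_eq :
    Real.log (((1 + Real.sqrt 5) / 2) ^ 5) = -5 * Real.log ((Real.sqrt 5 - 1) / 2) := by
  have h5 : (0 : ℝ) ≤ 5 := by norm_num
  have hs : Real.sqrt 5 * Real.sqrt 5 = 5 := Real.mul_self_sqrt h5
  have hpos : (0 : ℝ) < (Real.sqrt 5 - 1) / 2 := by
    have := Zudilin2003Growth.two_lt_sqrt_five
    linarith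
  have hprod : (Real.sqrt 5 - 1) / 2 * ((1 + Real.sqrt 5) / 2) = 1 := by nlinarith [hs]
  have hinv : ((Real.sqrt 5 - 1) / 2)⁻¹ = (1 + Real.sqrt 5) / 2 := inv_eq_of_mul_eq_one_right hprod
  rw [← hinv, inv_pow, Real.log_inv, Real.log_pow]
  push_cast
  ring

/-- **UNCONDITIONAL: the approximations `v_n/u_n` have effective exponent `> 0.5242` against the normaliser
`Q_n = 2^{4n+2} d_{2n}² u_n`** — eventually `0 < |G − v_n/u_n| < Q_n^{−0.5242}`.  (Exact exponent
`2 log((1+√5)/2)⁵ / (4 log 2 + 4 + log((1+√5)/2)⁵) = 0.524273…`.) -/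
theorem eventually_abs_sub_lt_rpow :
    ∀ᶠ n : ℕ in atTop,
      0 < |catalanConstant - (v n : ℝ) / (u n : ℝ)|
        ∧ |catalanConstant - (v n : ℝ) / (u n : ℝ)| < Q n ^ (-(0.5242 : ℝ)) := by
  set X : ℝ := Real.log (((1 + Real.sqrt 5) / 2) ^ 5) with hX
  -- the combined log-rate tends to a NEGATIVE limit
  have hlim : Tendsto (fun n : ℕ => Real.log |catalanConstant - vR n / uR n| / n
      + (0.5242 : ℝ) * (Real.log (Q n) / n)) atTop (𝓝 (-2 * X + 0.5242 * (4 * Real.log 2 + 4 + X))) :=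
    tendsto_log_abs_sub_catalan_div.add (tendsto_log_Q_div.const_mul _)
  have hneg : -2 * X + 0.5242 * (4 * Real.log 2 + 4 + X) < 0 := by
    obtain ⟨-, hl2⟩ := CatalanFamily.log_golden_inv_bounds
    have hX' : (2406 / 1000 : ℝ) < X := by rw [hX, log_golden_fifth_eq]; linarith
    have hlog2 := Real.log_two_lt_d9
    nlinarith
  have hev := (hlim.eventually (gt_mem_nhds hneg))
  filter_upwards [hev, eventually_ge_atTop 1] with n hn hn1
  have hu : (0 : ℝ) < (u n : ℝ) := uR_pos n
  have hne : catalanConstant - (v n : ℝ) / (u n : ℝ) ≠ 0 := by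
    intro h0
    apply form_ne_zero n
    unfold form
    have : catalanConstant = (v n : ℝ) / (u n : ℝ) := sub_eq_zero.mp h0
    rw [this, mul_div_assoc', mul_div_cancel_left₀ _ hu.ne', sub_self]
  have habs : 0 < |catalanConstant - (v n : ℝ) / (u n : ℝ)| := abs_pos.mpr hne
  refine ⟨habs, ?_⟩
  have hQ := Q_pos n
  have hnpos : (0 : ℝ) < n := by exact_mod_cast (show 0 < n by omega)
  -- from `log|…|/n + 0.5242 log Q/n < 0` get `log|…| < -0.5242 log Q = log (Q^{-0.5242})`
  have h1 : Real.log |catalanConstant - vR n / uR n| + 0.5242 * Real.log (Q n) < 0 := by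
    have := mul_neg_of_pos_of_neg hnpos hn
    have e : (n : ℝ) * (Real.log |catalanConstant - vR n / uR n| / n + 0.5242 * (Real.log (Q n) / n))
        = Real.log |catalanConstant - vR n / uR n| + 0.5242 * Real.log (Q n) := by
      field_simp
    linarith [e ▸ this]
  have h2 : Real.log |catalanConstant - (v n : ℝ) / (u n : ℝ)| < Real.log (Q n ^ (-(0.5242 : ℝ))) := by
    rw [Real.log_rpow hQ]
    have : vR n / uR n = (v n : ℝ) / (u n : ℝ) := rfl
    rw [this] at h1
    linarith
  exact (Real.log_lt_log_iff habs (Real.rpow_pos_of_pos hQ _)).mp h2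

/-- **The record exponent for `G`, realised by Zudilin's sequence, modulo the cited integrality of
[KrattenthalerRivoal2008Catalan]**: there are integer sequences `P_n, Q_n` with `Q_n = 2^{4n+2} d_{2n}² u_n`,
`P_n = 2^{4n+2} d_{2n}² v_n` for `n ≥ 1` and, eventually, `0 < |G − P_n/Q_n| < |Q_n|^{−0.5242}` — the typed shape
of the second clause of `Nesterenko2016.theorem_main` (ii); by [Zudilin2003Catalan, Thm 3] these are Nesterenko's
`(p_n, q_n)` up to the sign `(−1)^n` (cited, not proved here). -/
theorem record_of_krTheorems (hk : Literature.NumberTheory.Irrationality.Zudilin2003.krTheorems) :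
    ∃ P Qz : ℕ → ℤ,
      (∀ n : ℕ, 1 ≤ n →
          (Qz n : ℝ) = 2 ^ (4 * n + 2) * (Nat.lcmUpto (2 * n) : ℝ) ^ 2 * (u n : ℝ)
            ∧ (P n : ℝ) = 2 ^ (4 * n + 2) * (Nat.lcmUpto (2 * n) : ℝ) ^ 2 * (v n : ℝ))
        ∧ ∀ᶠ n : ℕ in atTop,
            0 < |catalanConstant - (P n : ℝ) / (Qz n : ℝ)|
              ∧ |catalanConstant - (P n : ℝ) / (Qz n : ℝ)| < |(Qz n : ℝ)| ^ (-(0.5242 : ℝ)) := by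
  classical
  -- integer values from the cited fact (for `n ≥ 1`; junk `0` at `n = 0`)
  have hq : ∀ n : ℕ, ∃ z : ℤ, 1 ≤ n → (z : ℚ) = 2 ^ (4 * n + 2) * (Nat.lcmUpto (2 * n) : ℚ) ^ 2 * u n := by
    intro n
    by_cases hn : 1 ≤ n
    · obtain ⟨⟨zu, hzu⟩, -⟩ := hk n hn
      refine ⟨zu * (Nat.lcmUpto (2 * n) : ℤ) ^ 2, fun _ => ?_⟩
      push_cast
      rw [hzu]
      ring
    · exact ⟨0, fun h => absurd h hn⟩
  have hp : ∀ n : ℕ, ∃ z : ℤ, 1 ≤ n → (z : ℚ) = 2 ^ (4 * n + 2) * (Nat.lcmUpto (2 * n) : ℚ) ^ 2 * v n := by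
    intro n
    by_cases hn : 1 ≤ n
    · obtain ⟨-, ⟨zv, hzv⟩⟩ := hk n hn
      exact ⟨zv, fun _ => hzv⟩
    · exact ⟨0, fun h => absurd h hn⟩
  choose Qz hQz using hq
  choose P hP using hp
  have hQR : ∀ n : ℕ, 1 ≤ n → (Qz n : ℝ) = Q n := by
    intro n hn
    have h := hQz n hn
    have h' : ((Qz n : ℚ) : ℝ) = ((2 ^ (4 * n + 2) * (Nat.lcmUpto (2 * n) : ℚ) ^ 2 * u n : ℚ) : ℝ) := by
      rw [h]
    push_cast at h'
    rw [Q]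
    exact h'
  have hPR : ∀ n : ℕ, 1 ≤ n → (P n : ℝ) = 2 ^ (4 * n + 2) * (Nat.lcmUpto (2 * n) : ℝ) ^ 2 * (v n : ℝ) := by
    intro n hn
    have h := hP n hn
    have h' : ((P n : ℚ) : ℝ) = ((2 ^ (4 * n + 2) * (Nat.lcmUpto (2 * n) : ℚ) ^ 2 * v n : ℚ) : ℝ) := by
      rw [h]
    push_cast at h'
    exact h'
  refine ⟨P, Qz, fun n hn => ⟨(hQR n hn).trans rfl, hPR n hn⟩, ?_⟩
  filter_upwards [eventually_abs_sub_lt_rpow, eventually_ge_atTop 1] with n hn hn1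
  have hQ := Q_pos n
  have hu : (0 : ℝ) < (u n : ℝ) := uR_pos n
  have hd : (0 : ℝ) < (Nat.lcmUpto (2 * n) : ℝ) := by exact_mod_cast Nat.lcmUpto_pos _
  have hratio : (P n : ℝ) / (Qz n : ℝ) = (v n : ℝ) / (u n : ℝ) := by
    rw [hQR n hn1, hPR n hn1, Q]
    field_simp
  rw [hratio, hQR n hn1, abs_of_pos hQ]
  exact hn

/-- **The same, with HALF of the cited integrality discharged** (lit g6, 2026-08-20): Krattenthaler–Rivoal's
Theorem 1 (`2^{4n} u_n ∈ ℤ`, hence `2^{4n+2} u_n ∈ ℤ`) is now PROVED in the tree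
(`Literature.NumberTheory.Irrationality.KrattenthalerRivoal2008.theorem1_printed`, via the binomial form
`u_eq_binomSum` of [KrattenthalerRivoal2008Catalan, Lemma 3]); only their Theorem 2 — the `d_{2n}²`-denominator of
`v_n` — remains an input. HONEST FRAMING: systematic search; no irrationality claim unless certified. -/
theorem record_of_krTheorem2
    (hk2 : ∀ n : ℕ, 1 ≤ n → ∃ z : ℤ, (z : ℚ) = 2 ^ (4 * n + 2) * (Nat.lcmUpto (2 * n) : ℚ) ^ 2 * v n) :
    ∃ P Qz : ℕ → ℤ,
      (∀ n : ℕ, 1 ≤ n →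
          (Qz n : ℝ) = 2 ^ (4 * n + 2) * (Nat.lcmUpto (2 * n) : ℝ) ^ 2 * (u n : ℝ)
            ∧ (P n : ℝ) = 2 ^ (4 * n + 2) * (Nat.lcmUpto (2 * n) : ℝ) ^ 2 * (v n : ℝ))
        ∧ ∀ᶠ n : ℕ in atTop,
            0 < |catalanConstant - (P n : ℝ) / (Qz n : ℝ)|
              ∧ |catalanConstant - (P n : ℝ) / (Qz n : ℝ)| < |(Qz n : ℝ)| ^ (-(0.5242 : ℝ)) :=
  record_of_krTheorems fun n hn =>
    ⟨Literature.NumberTheory.Irrationality.KrattenthalerRivoal2008.theorem1_printed n, hk2 n hn⟩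

end CatalanRecord

end Summit.KontsevichZagierPeriods.Zeta5Search
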